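import Summits.BirchSwinnertonDyer.BirchSwinnertonDyer.Theorems.QuadraticBranchSignedControlPlusEtaNonsurjLambdaTransferBinder
import Summits.BirchSwinnertonDyer.BirchSwinnertonDyer.Theorems.QuadraticBranchSignedControlPlusEtaNonsurjCMConjAAnchorTransferRecordsB
import Summits.BirchSwinnertonDyer.BirchSwinnertonDyer.Theorems.QuadraticBranchSignedControlPlusEtaNonsurjCMConjAAnchorTransferRecordsC
import Summits.BirchSwinnertonDyer.BirchSwinnertonDyer.Theorems.QuadraticBranchSignedControlPlusEtaNonsurjOfCMCongruentTransfer
import HarnessLib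

/-!
# Route `QuadraticBranchSignedControl` (rung K8, cell `bsd-potss`), residual crux `PlusEtaMainConjectureNonsurj`
# (stmt-BirchSwinnertonDyer-19606): Part XLVII — CONSUMERS OF THE BINDER THEOREM: (i) skeleton v7's composition `_of` with its
# `stub_etaMC_transferCL25` slot FILLED by Part XLVI (the crux from the four remaining stubs + cite-level facts); (ii) the two in-table
# rows with no other road, `242325g1` and `404325g1` (rank `1`, `λ⁺ = 5`), BY NAME without the preprint binder (seat `bsd-potss-k8eta-c2` g33)

WHY. Part XLVI (`corpuzLei2025_etaPlusMainConjecture_transfer_anMu_of_invariantFacts`) proves `CorpuzLei2025_etaPlusMainConjecture_transfer_anMu_OPEN`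
(= `Sig.stub_etaMC_transferCL25` of `Cruxes/PlusEtaMainConjectureNonsurj/Lines/birth.lean`) from `h46` (Hatley–Lei 2019 Thm. 4.6 + Prop. 5.1,
published), `h53` (Corpuz–Lei Thm. 5.3, accepted / to appear Math. Z.), Kobayashi `h22`/`h41`, modularity `hnf` and the period-integrality
input `hper`. THIS FILE substitutes that theorem (a) into k8eta-c2 g8's class theorem
`EtaCMCongruentTransfer.plusEtaMainConjectureNonsurj_of_cmConjA_of_transfer_of_uncongruent` — the `_of` of skeleton v7 — giving the crux
`PlusEtaMainConjectureNonsurj` from the THREE content stubs `(A)_cm`, `μ_an,cm`, `uncongruent` plus cite-level inputs ONLY (§138: the shape a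
planner's v8 re-cut would register; no stub is registered or closed here), and (b) into the two v7 records of the rows `242325g1`, `404325g1`
(the only in-table rank ≤ 1 non-CM rows that NO other road of the cell reaches — k8eta-c2 g32 / g33 census: their extra `λ` is the local term
`δ_359`, `δ_599` of the congruence with the anchor `675a1`) — §139.

HONEST FRAMING (cell `bsd-potss`; FULL-BSD rank ≤ 1 programme, HUMAN RULING D-0036/D-0074): BOOKKEEPING THEOREMS ONLY — no definition, no
named fact minted, no `sorry`, axioms standard; CONDITIONAL on the displayed named facts (`h46 h53 h22 h41 hnf hper h26 h6273`, a Fisher fact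
`hF`) and, for §139, the displayed anchor inputs ((A)(`675a1`) — DRS 3.7 certificate, kit j277504 — and the analytic `μ = 0` at the anchor's
twist). No stub of 19606 is proved or closed; skeleton v7 stands until a planner re-cuts it; the crux and the route stay OPEN; nothing is
booked; `BSD(W,5)` is claimed for no pair. `--supports stmt-BirchSwinnertonDyer-19606`.

References: [HatleyLei2019] Thm. 4.6, Prop. 5.1; [CorpuzLei2025] Thm. 5.3; [Kobayashi2003] Thm. 2.2, §4, Thm. 4.1, Thm. 6.2/6.3/7.3, Cor. 7.2;
[BurungaleTian2026] Thm. 2.6; [CoatesSujatha2005] §3 (A); [Fisher2012Hessian] Thm. 13.2; [Fisher2013TwistsOfX5] Thm. 5.8; [Cremona1997] Table 1.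
-/

set_option autoImplicit false
set_option linter.dupNamespace false
noncomputable section

open scoped Classical

open CongruenceSubgroup Field Function NumberField IsDedekindDomain WeierstrassCurve
open Literature.NumberTheory.EllipticCurves
open Literature.NumberTheory.EllipticCurves.ModularForms
open Literature.NumberTheory.GaloisRepresentations
open Literature.NumberTheory.EllipticCurves.IwasawaAlgebra
open Literature.NumberTheory.EllipticCurves.GreenbergVatsal2000
open Literature.NumberTheory.EllipticCurves.HesseFamilyFive (thm132_geomTorsionFive_of_hesseFamily thm58_geomTorsionFive_of_dualHesseFamily)
open ZpExtension
open Summit.BirchSwinnertonDyer.Rank1Residual.Additive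
open Summit.BirchSwinnertonDyer.Rank1Residual.O6 (ModPCongruent)
open Summit.BirchSwinnertonDyer.BirchSwinnertonDyer.Theses.QuadraticBranchSignedControl

namespace Summit.BirchSwinnertonDyer.BirchSwinnertonDyer.Theorems.EtaLambdaTransferRecords

/-! ## §138 Skeleton v7's `_of` with the binder slot filled -/

/-- **THE CRUX FROM THE THREE CONTENT STUBS OF v7 + CITE-LEVEL INPUTS (no preprint binder).** GRANTED (hypothesis position) Kobayashi
Thm. 2.2η (`h22`), Thm. 6.2/6.3/7.3 i)/Cor. 7.2η (`h6273`), Burungale–Tian Thm. 2.6 (`h26`) — v7's `stub_etaMC_publishedInputs` —, and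
Hatley–Lei Thm. 4.6 + Prop. 5.1 (`h46`), Corpuz–Lei Thm. 5.3 (`h53`), Kobayashi Thm. 4.1η (`h41`), modularity (`hnf`), the period input
(`hper`) — what Part XLVI turns into v7's `stub_etaMC_transferCL25` —: the crux `PlusEtaMainConjectureNonsurj` follows from v7's three CONTENT
stubs verbatim — (A) on the CM partners (`hAcm` = `Sig.stub_conjA_partners_cm`), the analytic `μ = 0` on the CM rows (`hμcm` =
`Sig.stub_analyticEtaMu_cm`), (C1⁺_η) on the uncongruent non-CM rows (`huncong` = `Sig.stub_etaMC_nonCM_uncongruent`) — through g8's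
`EtaCMCongruentTransfer.plusEtaMainConjectureNonsurj_of_cmConjA_of_transfer_of_uncongruent`. CONDITIONAL; registers / closes no stub
(a planner's re-cut would); nothing booked. [cite: Kobayashi2003, Thm. 2.2 (p. 5), §4 + Thm. 4.1 (p. 8), Thm. 6.2–7.3, Cor. 7.2]
[cite: BurungaleTian2026, Thm. 2.6] [cite: HatleyLei2019, Thm. 4.6, Prop. 5.1] [claim: CorpuzLei2025, status: under-review]
[cite: CoatesSujatha2005, §3 statement (A)] -/
theorem plusEtaMainConjectureNonsurj_of_cmConjA_of_analyticMu_of_uncongruent_of_invariantFacts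
    (h22 : Kobayashi2003.thm22_etaSignedSelmerDual_finite_torsion)
    (h6273 : Kobayashi2003.thm62_63_73_etaColemanPoitouTate)
    (h26 : BurungaleTian2026.thm26_etaKatoSequences_charIdeal_upToP_of_cm)
    (h46 : HatleyLei2019.thm46_prop51_etaSignedMuLambda_transfer_of_torsionIso)
    (h53 : CorpuzLei2025.thm53_etaPlusAnalyticMuLambda_transfer_of_torsionIso)
    (h41 : Kobayashi2003.thm41_plusEtaCharIdeal_dvd)
    (hnf : exists_isNewformOf)
    (hper : ∀ (V' : WeierstrassCurve ℚ) [V'.IsElliptic] [V'.IsGloballyMinimal] (p : ℕ) [Fact p.Prime]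
        {N' : ℕ} [NeZero N'] (f' : CuspForm (Gamma0 N') 2),
        p ≠ 2 → V'.HasGoodReductionAtPrime p → V'.frobeniusTrace p = 0 → IsNewformOf V' f' →
      ∃ ϖ' : ℚ, ‖(ϖ' : ℚ_[p])‖ ≤ 1 ∧
        (if Even (p / 2) then (ϖ' : ℝ) * V'.realPeriodRat = plusPeriod f'
          else (ϖ' : ℝ) * V'.imaginaryPeriodRat = minusPeriod f'))
    (hAcm : ∀ (V : WeierstrassCurve ℚ) [V.IsElliptic] [V.IsGloballyMinimal] (W : WeierstrassCurve ℚ) [W.IsElliptic]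
        [W.IsGloballyMinimal] (C : VariableChange ℚ) (p : ℕ) [Fact p.Prime],
        5 ≤ p → C • W.quadraticTwist ((-1) ^ (p / 2) * p) = V →
        V.HasGoodReductionAtPrime p → V.frobeniusTrace p = 0 →
        ¬ (∀ m : ℕ, V.HasSurjectiveModNGaloisRep (p ^ m : ℕ)) → V.HasCM →
        ∀ (κ : ZpExtension ℚ p), κ.IsCyclotomic →
          ∃ (γ : absoluteGaloisGroup ℚ) (D : W.FineSelmerDualData κ γ),
            Module.Finite ℤ_[p] (RestrictScalars ℤ_[p] (IwasawaAlgebra p) D.X))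
    (hμcm : ∀ (V : WeierstrassCurve ℚ) [V.IsElliptic] [V.IsGloballyMinimal] (p : ℕ) [Fact p.Prime],
        5 ≤ p → V.HasGoodReductionAtPrime p → V.frobeniusTrace p = 0 →
        ¬ (∀ m : ℕ, V.HasSurjectiveModNGaloisRep (p ^ m : ℕ)) → V.HasCM →
        ∀ {N : ℕ} [NeZero N] {f : CuspForm (Gamma0 N) 2}, IsNewformOf V f →
          ∀ (ϖ : ℚ), (if Even (p / 2) then (ϖ : ℝ) * V.realPeriodRat = plusPeriod f
              else (ϖ : ℝ) * V.imaginaryPeriodRat = minusPeriod f) →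
          ∀ (Lη : IwasawaAlgebra p), IsQuadraticBranchPlusLFunction f p ϖ Lη → HasUnitContent Lη)
    (huncong : ∀ (V : WeierstrassCurve ℚ) [V.IsElliptic] [V.IsGloballyMinimal] (p : ℕ) [Fact p.Prime],
        5 ≤ p → V.HasGoodReductionAtPrime p → V.frobeniusTrace p = 0 →
        ¬ (∀ m : ℕ, V.HasSurjectiveModNGaloisRep (p ^ m : ℕ)) → ¬ V.HasCM →
        ¬ (∃ (V'' : WeierstrassCurve ℚ) (_ : V''.IsElliptic) (_ : V''.IsGloballyMinimal),
            V''.HasCM ∧ V''.HasGoodReductionAtPrime p ∧ V''.frobeniusTrace p = 0 ∧ ModPCongruent V'' V p) →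
        QuadraticBranchPlusEtaMainConjectureAt V p) :
    PlusEtaMainConjectureNonsurj :=
  EtaCMCongruentTransfer.plusEtaMainConjectureNonsurj_of_cmConjA_of_transfer_of_uncongruent h22 h6273 h26
    (EtaLambdaTransfer.corpuzLei2025_etaPlusMainConjecture_transfer_anMu_of_invariantFacts h46 h53 h22 h41 hnf hper) hAcm
    (fun V _ _ p _ h5 hg ha hns hCM _ _ _ hf ϖ hϖ Lη hL => hμcm V p h5 hg ha hns hCM hf ϖ hϖ Lη hL) huncong

/-! ## §139 The two binder-only rows, without the binder -/

set_option maxRecDepth 100000 in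
/-- **(C1⁺_η) at `p = 5` for every good `a_5 = 0` globally minimal model `V` of the `5`-twist of `242325g1`** (`[0, 0, 1, -379500, -47684344]`;
non-CM, `Im ρ̄ = C_ns⁺(5)`, rank `1`, `λ⁺ = 5` = `λ⁺(675a1 ⊗ χ₅) + δ_359(W″) − δ_359(W) = 5 + 1 − 1`, Cremona `Tam = 2`, `#Ш_an = 1`): k8eta-c2
g8's (A)-anchored transfer record `EtaCMConjAAnchorTransferRecords.etaMC_242325g1_5_cmConjAAnchorTransfer` with its OPEN binder `hCL`
REPLACED by Part XLVI's theorem — i.e. CONDITIONAL on `h46` (Hatley–Lei, published), `h53` (Corpuz–Lei Thm. 5.3, accepted), `h22 h41 hnf hper`,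
`h26 h6273`, one Fisher fact, and the displayed anchor inputs ((A)(`675a1`), analytic `μ` at the anchor's twist). Nothing booked.
[cite: HatleyLei2019, Thm. 4.6, Prop. 5.1] [claim: CorpuzLei2025, status: under-review] [cite: Fisher2012Hessian, Thm. 13.2 (i)]
[cite: BurungaleTian2026, Thm. 2.6] [cite: CoatesSujatha2005, §3 statement (A)] [cite: Kobayashi2003, §4 Even main conjecture (p. 8)]
[cite: Cremona1997, Table 1 (labels 242325g1, 675a1)] -/
theorem etaMC_242325g1_5_lambdaTransfer
    (h46 : HatleyLei2019.thm46_prop51_etaSignedMuLambda_transfer_of_torsionIso)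
    (h53 : CorpuzLei2025.thm53_etaPlusAnalyticMuLambda_transfer_of_torsionIso)
    (h22 : Kobayashi2003.thm22_etaSignedSelmerDual_finite_torsion)
    (h41 : Kobayashi2003.thm41_plusEtaCharIdeal_dvd)
    (hnf : exists_isNewformOf)
    (hper : ∀ (V' : WeierstrassCurve ℚ) [V'.IsElliptic] [V'.IsGloballyMinimal] (p : ℕ) [Fact p.Prime]
        {N' : ℕ} [NeZero N'] (f' : CuspForm (Gamma0 N') 2),
        p ≠ 2 → V'.HasGoodReductionAtPrime p → V'.frobeniusTrace p = 0 → IsNewformOf V' f' →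
      ∃ ϖ' : ℚ, ‖(ϖ' : ℚ_[p])‖ ≤ 1 ∧
        (if Even (p / 2) then (ϖ' : ℝ) * V'.realPeriodRat = plusPeriod f'
          else (ϖ' : ℝ) * V'.imaginaryPeriodRat = minusPeriod f'))
    (h26 : BurungaleTian2026.thm26_etaKatoSequences_charIdeal_upToP_of_cm)
    (h6273 : Kobayashi2003.thm62_63_73_etaColemanPoitouTate) (hF : thm132_geomTorsionFive_of_hesseFamily)
    (W : WeierstrassCurve ℚ) (hW : W = ⟨0, 0, 1, (-379500), (-47684344)⟩) (A : WeierstrassCurve ℚ) (hA : A = ⟨0, 0, 1, 0, 31⟩)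
    (hAA : ∀ (κ : ZpExtension ℚ 5), κ.IsCyclotomic →
      ∃ (γ : absoluteGaloisGroup ℚ) (D : A.FineSelmerDualData κ γ),
        Module.Finite ℤ_[5] (RestrictScalars ℤ_[5] (IwasawaAlgebra 5) D.X)) :
    ∀ (V'' : WeierstrassCurve ℚ) [V''.IsElliptic] [V''.IsGloballyMinimal]
      (V : WeierstrassCurve ℚ) [V.IsElliptic] [V.IsGloballyMinimal] [Fact (5 : ℕ).Prime],
      (∃ C'' : VariableChange ℚ, C'' • A.quadraticTwist (5) = V'') →
      V''.HasGoodReductionAtPrime 5 → V''.frobeniusTrace 5 = 0 →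
      (∀ {N : ℕ} [NeZero N] {f : CuspForm (Gamma0 N) 2}, IsNewformOf V'' f →
        ∀ (ϖ : ℚ), (if Even (5 / 2) then (ϖ : ℝ) * V''.realPeriodRat = plusPeriod f
            else (ϖ : ℝ) * V''.imaginaryPeriodRat = minusPeriod f) →
        ∀ (Lη : IwasawaAlgebra 5), IsQuadraticBranchPlusLFunction f 5 ϖ Lη → HasUnitContent Lη) →
      (∃ C : VariableChange ℚ, C • W.quadraticTwist (5) = V) →
      V.HasGoodReductionAtPrime 5 → V.frobeniusTrace 5 = 0 →
      QuadraticBranchPlusEtaMainConjectureAt V 5 :=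
  EtaCMConjAAnchorTransferRecords.etaMC_242325g1_5_cmConjAAnchorTransfer
    (EtaLambdaTransfer.corpuzLei2025_etaPlusMainConjecture_transfer_anMu_of_invariantFacts h46 h53 h22 h41 hnf hper) h26 h22 h6273 hF
    W hW A hA hAA

set_option maxRecDepth 100000 in
/-- **(C1⁺_η) at `p = 5` for every good `a_5 = 0` globally minimal model `V` of the `5`-twist of `404325g1`** (`[0, 0, 1, -30778500, -65718132719]`;
non-CM, `Im ρ̄ = C_ns⁺(5)`, rank `1`, `λ⁺ = 5` = `λ⁺(675a1 ⊗ χ₅) + δ_599(W″) − δ_599(W) = 5 + 5 − 5` (`599⁴ ≡ 1 mod 25`: `s_599 = 5`), Cremona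
`Tam = 6`, `#Ш_an = 1`): k8eta-c2 g8's record `EtaCMConjAAnchorTransferRecords.etaMC_404325g1_5_cmConjAAnchorTransfer` with its OPEN binder `hCL`
REPLACED by Part XLVI's theorem — CONDITIONAL on `h46 h53 h22 h41 hnf hper h26 h6273`, one Fisher fact and the displayed anchor inputs.
Nothing booked. [cite: HatleyLei2019, Thm. 4.6, Prop. 5.1] [claim: CorpuzLei2025, status: under-review] [cite: Fisher2013TwistsOfX5, Thm. 5.8]
[cite: BurungaleTian2026, Thm. 2.6] [cite: CoatesSujatha2005, §3 statement (A)] [cite: Kobayashi2003, §4 Even main conjecture (p. 8)]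
[cite: Cremona1997, Table 1 (labels 404325g1, 675a1)] -/
theorem etaMC_404325g1_5_lambdaTransfer
    (h46 : HatleyLei2019.thm46_prop51_etaSignedMuLambda_transfer_of_torsionIso)
    (h53 : CorpuzLei2025.thm53_etaPlusAnalyticMuLambda_transfer_of_torsionIso)
    (h22 : Kobayashi2003.thm22_etaSignedSelmerDual_finite_torsion)
    (h41 : Kobayashi2003.thm41_plusEtaCharIdeal_dvd)
    (hnf : exists_isNewformOf)
    (hper : ∀ (V' : WeierstrassCurve ℚ) [V'.IsElliptic] [V'.IsGloballyMinimal] (p : ℕ) [Fact p.Prime]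
        {N' : ℕ} [NeZero N'] (f' : CuspForm (Gamma0 N') 2),
        p ≠ 2 → V'.HasGoodReductionAtPrime p → V'.frobeniusTrace p = 0 → IsNewformOf V' f' →
      ∃ ϖ' : ℚ, ‖(ϖ' : ℚ_[p])‖ ≤ 1 ∧
        (if Even (p / 2) then (ϖ' : ℝ) * V'.realPeriodRat = plusPeriod f'
          else (ϖ' : ℝ) * V'.imaginaryPeriodRat = minusPeriod f'))
    (h26 : BurungaleTian2026.thm26_etaKatoSequences_charIdeal_upToP_of_cm)
    (h6273 : Kobayashi2003.thm62_63_73_etaColemanPoitouTate) (hF : thm58_geomTorsionFive_of_dualHesseFamily)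
    (W : WeierstrassCurve ℚ) (hW : W = ⟨0, 0, 1, (-30778500), (-65718132719)⟩) (A : WeierstrassCurve ℚ) (hA : A = ⟨0, 0, 1, 0, 31⟩)
    (hAA : ∀ (κ : ZpExtension ℚ 5), κ.IsCyclotomic →
      ∃ (γ : absoluteGaloisGroup ℚ) (D : A.FineSelmerDualData κ γ),
        Module.Finite ℤ_[5] (RestrictScalars ℤ_[5] (IwasawaAlgebra 5) D.X)) :
    ∀ (V'' : WeierstrassCurve ℚ) [V''.IsElliptic] [V''.IsGloballyMinimal]
      (V : WeierstrassCurve ℚ) [V.IsElliptic] [V.IsGloballyMinimal] [Fact (5 : ℕ).Prime],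
      (∃ C'' : VariableChange ℚ, C'' • A.quadraticTwist (5) = V'') →
      V''.HasGoodReductionAtPrime 5 → V''.frobeniusTrace 5 = 0 →
      (∀ {N : ℕ} [NeZero N] {f : CuspForm (Gamma0 N) 2}, IsNewformOf V'' f →
        ∀ (ϖ : ℚ), (if Even (5 / 2) then (ϖ : ℝ) * V''.realPeriodRat = plusPeriod f
            else (ϖ : ℝ) * V''.imaginaryPeriodRat = minusPeriod f) →
        ∀ (Lη : IwasawaAlgebra 5), IsQuadraticBranchPlusLFunction f 5 ϖ Lη → HasUnitContent Lη) →
      (∃ C : VariableChange ℚ, C • W.quadraticTwist (5) = V) →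
      V.HasGoodReductionAtPrime 5 → V.frobeniusTrace 5 = 0 →
      QuadraticBranchPlusEtaMainConjectureAt V 5 :=
  EtaCMConjAAnchorTransferRecords.etaMC_404325g1_5_cmConjAAnchorTransfer
    (EtaLambdaTransfer.corpuzLei2025_etaPlusMainConjecture_transfer_anMu_of_invariantFacts h46 h53 h22 h41 hnf hper) h26 h22 h6273 hF
    W hW A hA hAA

end Summit.BirchSwinnertonDyer.BirchSwinnertonDyer.Theorems.EtaLambdaTransferRecords

end
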